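import Literature.NumberTheory.EllipticCurves.SzpiroSmallJDenominator
import Literature.NumberTheory.EllipticCurves.JInvariantDenominator
import Literature.NumberTheory.DiophantineGeometry.FaltingsHeightJInvariantExplicit
import Literature.NumberTheory.EllipticCurves.HeightConductorBoundsModularityProofs
import HarnessLib

/-!
# Pasten 2023, Cor 2.1 (`h(j_E) ≤ 16 N_E log N_E`) PROVED from Murty–Pasten's height bound
# (proofs-only companion of `SzpiroSmallJDenominator.lean`; theorems only, D-0026)

Topic `Literature/NumberTheory/EllipticCurves` (family `abc`, LADDER-ABC A1, the *modular method*;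
cell abc-stewartyu, seat lit-abc-pasten g4). Source: H. Pasten, *Szpiro's conjecture when the
denominator of the `j`-invariant is small*, Cubo **28** (2026) 383 = arXiv:2308.07114
[`Pasten2023SzpiroSmallDenominator`], §2 (READ, arXiv p. 2):

> "In [MP13], Murty and the author used the theory of modular forms to prove the following explicit
> bound for all `E` over `ℚ`: `h(E) < 0.1 · N_E log N_E + 11`. … It turns out that `h(E)` is related
> to `h(j_E)` in a very explicit way; Silverman [12] proved `h(j_E) ≤ 12 h(E) + O(log(2 + h(j_E)))` …
> This has been made explicit by Pellarin [9] … Lemme 5.2 in [9] is enough; this gives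
> `h(j_E) ≤ 24 max{1, h(E)} + 94.3`. Putting these results together we obtain:
> **Corollary 2.1.** For all elliptic curves `E` over `ℚ` we have `h(j_E) ≤ 16 · N_E log N_E`.
> *Proof.* … `h(j_E) ≤ 94.3 + 24 · (0.1 · N_E log N_E + 11) = 2.4 · N_E log N_E + 358.3`. The result
> follows from the well-known fact that `N_E ≥ 11` for all elliptic curves over `ℚ`."

This file PROVES the named fact `Pasten2023_cor_2_1` of the sibling from the named fact
`MurtyPasten.faltingsHeight_lt` (Murty–Pasten 2013 Thm 7.1, `CongruenceNumberLevelBound.lean`) —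
`Pasten2023_cor_2_1_of_murtyPasten` — with ONE deviation from print, documented: instead of Pellarin's
Lemme 5.2 (not in the tree) we use the tree's PROVED explicit form of Silverman's comparison,
`jHeight_le_stableFaltingsHeight_explicit` (`FaltingsHeightJInvariantExplicit.lean`:
`h(j) ≤ 12 h_F + 6 log(1 + h(j)) + 37`, stable height), together with `h_F ≤ h(E/ℚ)` (stable ≤
Faltings' height over `ℚ`, `stableFaltingsHeight_le_faltingsHeight_rat`, PROVED here: the denominator
ideal `𝔇` of `j` contains `den(j)`, which divides the minimal discriminant). The resulting chain
`h(j) ≤ 1.2 N log N + 169 + 6 log(1 + h(j))` closes to `16 N log N` for `N log N ≥ 22` by the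
elementary `log(1 + x) ≤ (1 + x)/64 − 1 + log 64`; `N_E ≥ 11` is the tree's
`eleven_le_conductorNorm_of_modularity` (from the Modularity Theorem, named fact
`nonempty_modularParametrizationData` — the "well-known fact" is a theorem of Ogg–Tate type in print
and of modularity in the tree). Net effect: `Pasten2023_cor_2_1` (and with it the sibling's PROVED
`Pasten2023_thm_1_2_of_cor`, Cor 1.3) now rests on {`MurtyPasten.faltingsHeight_lt`,
`nonempty_modularParametrizationData`, `Pasten2023_cor_3_4`}.

## Contents (all PROVED; no definitions, no new facts)

* `WeierstrassCurve.stableFaltingsHeight_rat` — over `ℚ`, `h_F(E) = (1/12)(log N(𝔇_j) − archTerm)`.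
* `WeierstrassCurve.absNorm_jDenominatorIdeal_le_minimalDiscriminantNorm` — for a globally minimal
  `W/ℚ`, `N(𝔇_j) ≤ |Δ_min|` (`den(j) ∈ 𝔇_j`, `den(j) ∣ Δ_min`).
* `WeierstrassCurve.stableFaltingsHeight_le_faltingsHeight_rat` — `h_F(E) ≤ h(E/ℚ)` for every `E/ℚ`.
* `logHeight₁_j_le_faltingsHeight_explicit` — `h(j_E) ≤ 12 h(E/ℚ) + 6 log(1 + h(j_E)) + 37`.
* `Pasten2023_cor_2_1_of_murtyPasten` — **Cor 2.1 from MP Thm 7.1 and `N_E ≥ 11`**.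

WHAT THIS IS NOT: no discharge of `MurtyPasten.faltingsHeight_lt` (explicit constants of the Hecke
index; see `CongruenceNumberLevelBoundProofs.lean` for its reduction to {modularity, Mazur–Kenku,
MP Thm 4.3}); no claim on `abc`; Pellarin's Lemme 5.2 is neither typed nor used.

## References

* [Pasten2023SzpiroSmallDenominator] H. Pasten, Cubo 28 (2026) 383 = arXiv:2308.07114: §2, Cor. 2.1.
* [MurtyPasten2013] M. R. Murty, H. Pasten, J. Number Theory 133 (2013), Thm 7.1.
* [Silverman1986] J. H. Silverman, *Heights and elliptic curves*, in Arithmetic Geometry (1986),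
  Prop. 2.1 (the tree's explicit form, constants `(9, 37)`).
-/

noncomputable section

open Height NumberField

namespace WeierstrassCurve

variable (W : WeierstrassCurve ℚ) [W.IsElliptic]

/-- Over `ℚ` the stable Faltings height has the single archimedean term:
`h_F(E) = (1/12)(log N(𝔇_j) − archTerm(E_ℂ))` (`[ℚ:ℚ] = 1`, one embedding; cf.
`faltingsHeight_rat`). [cite: Silverman1986, Prop. 1.1 and §2 (p. 257)] -/
theorem stableFaltingsHeight_rat :
    W.stableFaltingsHeight = (12 : ℝ)⁻¹ *
      (Real.log (Ideal.absNorm W.jDenominatorIdeal) - (W.baseChange ℂ).faltingsArchTerm) := by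
  unfold stableFaltingsHeight
  rw [Module.finrank_self, Nat.cast_one, mul_one, Fintype.sum_subsingleton _ (algebraMap ℚ ℂ)]
  rfl

/-- For a globally minimal `W/ℚ`: `N(𝔇_j) ≤ |Δ_min|`, since `den(j) ∈ 𝔇_j` (so `N(𝔇_j) ∣ den(j)`)
and `den(j) ∣ Δ_min` (`den_j_dvd_natAbs_minimalDiscriminantInt`; `j = c₄³/Δ_min` with `c₄ ∈ ℤ`).
Silverman 1986 §2: `𝔇 ∣ Δ_{E/K}`. [cite: Silverman1986, §2 (p. 257: (j) = 𝔄𝔇⁻¹, 𝔇 ∣ Δ_{E/K})] -/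
theorem absNorm_jDenominatorIdeal_le_minimalDiscriminantNorm [W.IsGloballyMinimal] :
    Ideal.absNorm W.jDenominatorIdeal ≤ W.minimalDiscriminantNorm ℤ := by
  set q : ℚ := W.j with hq
  -- `den(j) ∈ 𝔇_j`
  have hmem : ((q.den : ℤ) : 𝓞 ℚ) ∈ W.jDenominatorIdeal := by
    rw [WeierstrassCurve.mem_jDenominatorIdeal]
    refine ⟨(q.num : ℤ), ?_⟩
    have e1 : (((q.den : ℤ) : 𝓞 ℚ) : ℚ) = (q.den : ℚ) := by
      rw [RingOfIntegers.coe_eq_algebraMap, map_intCast]; push_cast; rfl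
    have e2 : (((q.num : ℤ) : 𝓞 ℚ) : ℚ) = (q.num : ℚ) := by
      rw [RingOfIntegers.coe_eq_algebraMap, map_intCast]
    rw [e1, e2, ← hq, mul_comm, Rat.mul_den_eq_num]
  have hle : Ideal.span {((q.den : ℤ) : 𝓞 ℚ)} ≤ W.jDenominatorIdeal :=
    (Ideal.span_singleton_le_iff_mem _).2 hmem
  have hdvd := Ideal.absNorm_dvd_absNorm_of_le hle
  have hspan : Ideal.absNorm (Ideal.span {((q.den : ℤ) : 𝓞 ℚ)}) = q.den := by
    rw [Ideal.absNorm_span_singleton,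
      show ((q.den : ℤ) : 𝓞 ℚ) = algebraMap ℤ (𝓞 ℚ) q.den by simp,
      Algebra.norm_algebraMap, RingOfIntegers.rank, Module.finrank_self]
    simp
  have h1 : Ideal.absNorm W.jDenominatorIdeal ≤ q.den := by
    have := Nat.le_of_dvd (by rw [hspan]; exact q.den_pos) hdvd
    rwa [hspan] at this
  -- `den(j) ∣ Δ_min`
  have h2 : q.den ≤ W.minimalDiscriminantNorm ℤ := by
    have hD : W.minimalDiscriminantNorm ℤ = (minimalDiscriminantInt W).natAbs :=
      minimalDiscriminantNorm_int_eq_natAbs_minimalDiscriminantInt_holds W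
    have hden : q.den ∣ W.minimalDiscriminantNorm ℤ :=
      hD ▸ Literature.NumberTheory.EllipticCurves.den_j_dvd_natAbs_minimalDiscriminantInt W
    exact Nat.le_of_dvd (minimalDiscriminantNorm_pos_holds W) hden
  exact h1.trans h2

/-- **The stable Faltings height is at most the Faltings height over `ℚ`**: `h_F(E) ≤ h(E/ℚ)`
(Silverman 1986, Remark 1.2 (1) and §2: `h(E/K) − h_F(E) = (12[K:ℚ])⁻¹ log N Υ_{E/K} ≥ 0` with
`Υ = Δ_min / 𝔇`). Over the tree: both heights are model invariants, so pass to a global minimal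
model (`hasGlobalMinimalModel_rat_holds`), where `N(𝔇_j) ≤ |Δ_min|`
(`absNorm_jDenominatorIdeal_le_minimalDiscriminantNorm`). [cite: Silverman1986, Remark 1.2 (1) and §2 (p. 257)] -/
theorem stableFaltingsHeight_le_faltingsHeight_rat :
    W.stableFaltingsHeight ≤ W.faltingsHeight := by
  obtain ⟨C, hC⟩ := hasGlobalMinimalModel_rat_holds W
  haveI := hC
  rw [← faltingsHeight_smul W C, ← stableFaltingsHeight_smul W C, stableFaltingsHeight_rat,
    faltingsHeight_rat]
  have h0 : 0 < Ideal.absNorm (C • W).jDenominatorIdeal := by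
    rw [Nat.pos_iff_ne_zero, Ne, Ideal.absNorm_eq_zero_iff]
    exact (C • W).jDenominatorIdeal_ne_bot
  have hle : (Ideal.absNorm (C • W).jDenominatorIdeal : ℝ) ≤ ((C • W).minimalDiscriminantNorm ℤ : ℝ) := by
    exact_mod_cast absNorm_jDenominatorIdeal_le_minimalDiscriminantNorm (C • W)
  have hlog : Real.log (Ideal.absNorm (C • W).jDenominatorIdeal : ℝ) ≤
      Real.log ((C • W).minimalDiscriminantNorm ℤ : ℝ) :=
    Real.log_le_log (by exact_mod_cast h0) hle
  have h12 : (0 : ℝ) ≤ (12 : ℝ)⁻¹ := by norm_num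
  exact mul_le_mul_of_nonneg_left (by linarith) h12

end WeierstrassCurve

namespace Literature.NumberTheory.EllipticCurves

open WeierstrassCurve DiophantineGeometry

/-- **`h(j_E) ≤ 12 h(E/ℚ) + 6 log(1 + h(j_E)) + 37` for every elliptic curve over `ℚ`** — the tree's
explicit Silverman comparison `jHeight_le_stableFaltingsHeight_explicit`
(`h(j) ≤ 12 h_F + 6 log(1 + h(j)) + 37`, `[ℚ:ℚ] = 1`) followed by `h_F ≤ h(E/ℚ)`. This is the role
played by Pellarin's Lemme 5.2 (`h(j_E) ≤ 24 max{1, h(E)} + 94.3`) in Pasten's proof of Cor 2.1.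
[cite: Silverman1986, Prop. 2.1] [cite: Pasten2023SzpiroSmallDenominator, §2 (Silverman/Pellarin comparison)] -/
theorem logHeight₁_j_le_faltingsHeight_explicit (W : WeierstrassCurve ℚ) [W.IsElliptic] :
    logHeight₁ W.j ≤ 12 * W.faltingsHeight + 6 * Real.log (1 + logHeight₁ W.j) + 37 := by
  have h := jHeight_le_stableFaltingsHeight_explicit ℚ W
  simp only [Module.finrank_self, Nat.cast_one, inv_one, one_mul] at h
  have hst := W.stableFaltingsHeight_le_faltingsHeight_rat
  linarith

/-- **Pasten 2023, Corollary 2.1 (`h(j_E) ≤ 16 · N_E log N_E` for all `E/ℚ`) PROVED from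
Murty–Pasten's Theorem 7.1** (`MurtyPasten.faltingsHeight_lt`: `h(E) < 0.1 N_E log N_E + 11`) and
`N_E ≥ 11` (`eleven_le_conductorNorm_of_modularity`, from the Modularity Theorem
`nonempty_modularParametrizationData`). Printed proof (§2) with Pellarin's Lemme 5.2 replaced by the
tree's explicit Silverman comparison (`logHeight₁_j_le_faltingsHeight_explicit`): writing
`x = h(j_E)`, `L = N_E log N_E ≥ 11 log 11 > 22`, one has `x ≤ 1.2 L + 169 + 6 log(1 + x)` and
`log(1 + x) ≤ (1 + x)/64 − 1 + log 64`, whence `0.91 x ≤ 1.2 L + 189` and `x ≤ 16 L`.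
[cite: Pasten2023SzpiroSmallDenominator, Cor. 2.1 (§2, proof)] [cite: MurtyPasten2013, Thm 7.1] -/
theorem Pasten2023_cor_2_1_of_murtyPasten (hMP : MurtyPasten.faltingsHeight_lt)
    (hmod : ModularForms.nonempty_modularParametrizationData) : Pasten2023_cor_2_1 := by
  intro W _
  have h11 : 11 ≤ W.conductorNorm ℤ := ModularForms.eleven_le_conductorNorm_of_modularity hmod W
  have h1 := logHeight₁_j_le_faltingsHeight_explicit W
  have h2 := hMP W
  set N : ℝ := (W.conductorNorm ℤ : ℝ) with hNdef
  set x : ℝ := logHeight₁ W.j with hxdef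
  have hx0 : 0 ≤ x := zero_le_logHeight₁ _
  have hN11 : (11 : ℝ) ≤ N := by rw [hNdef]; exact_mod_cast h11
  have hl2 := Real.log_two_gt_d9
  have hl2' := Real.log_two_lt_d9
  -- `log N ≥ log 8 = 3 log 2 > 2`
  have hlogN : 2 ≤ Real.log N := by
    have h8 : Real.log 8 ≤ Real.log N := Real.log_le_log (by norm_num) (by linarith)
    rw [show (8 : ℝ) = 2 ^ 3 by norm_num, Real.log_pow] at h8
    push_cast at h8
    linarith
  set L : ℝ := N * Real.log N with hLdef
  have hL : 22 ≤ L := by rw [hLdef]; nlinarith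
  -- `6 log(1 + x) ≤ (6/64)(1 + x) − 6 + 6 log 64`, `log 64 = 6 log 2 < 4.16`
  have h1x : 0 < 1 + x := by linarith
  have hlog64 : Real.log 64 = 6 * Real.log 2 := by
    rw [show (64 : ℝ) = 2 ^ 6 by norm_num, Real.log_pow]; push_cast; ring
  have hlog1x : Real.log (1 + x) ≤ (1 + x) / 64 - 1 + Real.log 64 := by
    have h := Real.log_le_sub_one_of_pos (show 0 < (1 + x) / 64 by positivity)
    rw [Real.log_div h1x.ne' (by norm_num)] at h
    linarith
  -- assemble: `x ≤ 12 h + 6 log(1+x) + 37`, `h < 0.1 L + 11`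
  have hchain : x ≤ 1.2 * L + 169 + 6 * Real.log (1 + x) := by
    rw [hLdef]; linarith
  rw [show (16 : ℝ) * N * Real.log N = 16 * L by rw [hLdef]; ring]
  linarith

end Literature.NumberTheory.EllipticCurves

end
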